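import Summits.SmoothPoincare4.SmoothPoincare4.Theorems.SullivanDualWitnessChargeFlatChart
import Summits.SmoothPoincare4.SmoothPoincare4.Theorems.SullivanDualWitnessChargeSubstubFar
import Summits.SmoothPoincare4.SmoothPoincare4.Theorems.SullivanDualWitnessChargeLocalFamilyUniv

/-!
# Stub `stub_memberSphere` of skeleton v15, auxiliary file (crux `WitnessCharge`,
stmt-SmoothPoincare4-7824, route `SullivanDual`, line `Sketch`, lead c8)

Registered helpers of the stub `stub_memberSphere` (the compactified pencil member as an
embedded two-chart `JX`-sphere of the cap model, `Theorems/SullivanDualWitnessChargeCapDefs.lean`)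
that do not mention the cap data itself:

* `helper_memberSphere_capGerm` — the removable singularity of a member at infinity in the
  cap-chart coordinates `(t, σ) = (1/z, w)`: `w ↦ (1/z, w)(u(lam/w))` extends analytically across
  `w = 0` with value `(0, b)` and derivative `(lam⁻¹, c)` (from
  `IsPencilPlane.analyticAt_fst/snd_pencilCoord_inv`: `1/z(u(1/η)) = η / (1 + η ψ(η))` with
  `ψ(η) = z(u(1/η)) − 1/η` analytic);
* `helper_memberSphere_scale` — admissible scales exist (properness + asymptotics of a member);
* `helper_memberSphere_YcoordSubmersion` — the flat chart `Ycoord p` has onto differential on the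
  punctured chart-ball (injective by `injective_Dpsi`, equal dimensions);
* `helper_memberSphere_eq_farLine` — a point of the punctured `ε'`-chart-ball with `w`-coordinate
  `b_f` lies on the far flat line of intercept `b_f` (the flat chart is injective on the ball);
* `helper_memberSphere_Vzero` — the `w`-chart `V` of the compactified member at `w = 0`, for ANY
  cap chart `capInv` (smooth on `{‖t‖ < ρ}`, immersive, `JX = i` there, `capInv (z⁻¹, w) = ι x`):
  `V = capInv ∘ k` near `0` for the germ `k` above, hence smooth, immersed and `JX`-holomorphic at
  `0`. The stub file instantiates it with the fields of `CapData`.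
-/

noncomputable section

set_option linter.dupNamespace false

open scoped Manifold ContDiff Topology
open Set Filter Literature.Geometry.Symplectic Literature.Topology.FourManifolds

namespace Summit.SmoothPoincare4.SmoothPoincare4.Theorems.WitnessCharge.PencilIncompleteness

/-- **The germ of the compactified member at the point at infinity** (registered helper of
`stub_memberSphere`). For a member `u` of intercept `b` (with `J` standard on the punctured
`ε'`-ball) and a scale `lam ≠ 0`, the cap-chart coordinates `(1/z, w)(u (lam / w))` extend
analytically across `w = 0` with value `(0, b)` and derivative `(lam⁻¹, c)` there: with
`ψ(η) = z(u(1/η)) − 1/η` and `g(η) = w(u(1/η))` (analytic at `0` by the removable singularity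
theorem, `IsPencilPlane.analyticAt_fst/snd_pencilCoord_inv`), `1/z(u(1/η)) = η / (1 + η ψ(η))`. -/
theorem helper_memberSphere_capGerm :
    ∀ (S : HomotopySphere 4) (p : S.carrier)
      (J : ∀ x : punctured p, TangentSpace (𝓡 4) x →L[ℝ] TangentSpace (𝓡 4) x) (ε' : ℝ)
      (u : ℂ → punctured p) (b : ℂ) (lam : ℝ),
      0 < ε' →
      (∀ x : punctured p, InPuncturedChartBall p ε' x →
        ∀ (v : TangentSpace (𝓡 4) x) (c : EuclideanSpace ℝ (Fin 4)),
          inner ℝ (fderiv ℝ inversion (extChartAt (𝓡 4) p x.1 - extChartAt (𝓡 4) p p)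
            (mfderiv (𝓡 4) 𝓘(ℝ, EuclideanSpace ℝ (Fin 4))
              (fun z : punctured p => extChartAt (𝓡 4) p z.1) x (J x v))) c
          = stdSymplecticForm (fderiv ℝ inversion (extChartAt (𝓡 4) p x.1 - extChartAt (𝓡 4) p p)
            (mfderiv (𝓡 4) 𝓘(ℝ, EuclideanSpace ℝ (Fin 4))
              (fun z : punctured p => extChartAt (𝓡 4) p z.1) x v)) c) →
      IsPencilMember J u b → lam ≠ 0 →
      ∃ (k : ℂ → ℂ × ℂ) (c : ℂ), AnalyticAt ℂ k 0 ∧ HasDerivAt k ((lam : ℂ)⁻¹, c) 0 ∧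
        k 0 = (0, b) ∧ ∀ w : ℂ, w ≠ 0 → k w =
          (((Ycoord p (u ((lam : ℂ) * w⁻¹))).1)⁻¹, (Ycoord p (u ((lam : ℂ) * w⁻¹))).2) := by
  intro S p J ε' u b lam hε' hstd hu hlam
  have hP : IsPencilPlane J u b := hu
  obtain ⟨ψ, hψdef⟩ : ∃ ψ : ℂ → ℂ,
      ψ = Function.update (fun η : ℂ => (pencilCoord p (u η⁻¹)).1 - η⁻¹) 0 0 := ⟨_, rfl⟩
  obtain ⟨g, hgdef⟩ : ∃ g : ℂ → ℂ,
      g = Function.update (fun η : ℂ => (pencilCoord p (u η⁻¹)).2) 0 b := ⟨_, rfl⟩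
  have hψ : AnalyticAt ℂ ψ 0 := by rw [hψdef]; exact hP.analyticAt_fst_pencilCoord_inv hε' hstd
  have hg : AnalyticAt ℂ g 0 := by rw [hgdef]; exact hP.analyticAt_snd_pencilCoord_inv hε' hstd
  -- `h η = η / (1 + η ψ η)` is analytic at `0` with `h 0 = 0`, `h' 0 = 1`
  have hd : AnalyticAt ℂ (fun η : ℂ => 1 + η * ψ η) 0 :=
    analyticAt_const.add (analyticAt_id.mul hψ)
  have hd0 : (fun η : ℂ => 1 + η * ψ η) 0 ≠ 0 := by simp
  have hh : AnalyticAt ℂ (fun η : ℂ => η / (1 + η * ψ η)) 0 := analyticAt_id.div hd hd0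
  have hh' : HasDerivAt (fun η : ℂ => η / (1 + η * ψ η)) 1 0 := by
    refine ((hasDerivAt_id (0 : ℂ)).div hd.differentiableAt.hasDerivAt hd0).congr_deriv ?_
    simp
  have hK : AnalyticAt ℂ (fun η : ℂ => (η / (1 + η * ψ η), g η)) 0 := hh.prod hg
  have hK' : HasDerivAt (fun η : ℂ => (η / (1 + η * ψ η), g η)) (1, deriv g 0) 0 :=
    hh'.prodMk hg.differentiableAt.hasDerivAt
  have hl : HasDerivAt (fun w : ℂ => (lam : ℂ)⁻¹ * w) (lam : ℂ)⁻¹ 0 := by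
    simpa using (hasDerivAt_id (0 : ℂ)).const_mul (lam : ℂ)⁻¹
  have hl0 : (fun w : ℂ => (lam : ℂ)⁻¹ * w) 0 = 0 := mul_zero _
  refine ⟨(fun η : ℂ => (η / (1 + η * ψ η), g η)) ∘ fun w : ℂ => (lam : ℂ)⁻¹ * w,
    (lam : ℂ)⁻¹ * deriv g 0, hK.comp_of_eq (analyticAt_const.mul analyticAt_id) hl0, ?_, ?_, ?_⟩
  · refine (hK'.scomp_of_eq (0 : ℂ) hl hl0.symm).congr_deriv ?_
    simp [Prod.smul_mk]
  · simp only [Function.comp_apply, mul_zero, zero_mul, add_zero, div_one, hgdef,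
      Function.update_self]
  · intro w hw
    have hη : (lam : ℂ)⁻¹ * w ≠ 0 := mul_ne_zero (inv_ne_zero (Complex.ofReal_ne_zero.2 hlam)) hw
    have hηinv : ((lam : ℂ)⁻¹ * w)⁻¹ = (lam : ℂ) * w⁻¹ := by rw [mul_inv, inv_inv]
    simp only [Function.comp_apply, hgdef, hψdef, Function.update_of_ne hη, hηinv]
    refine Prod.ext ?_ rfl
    show (lam : ℂ)⁻¹ * w /
        (1 + (lam : ℂ)⁻¹ * w * ((pencilCoord p (u ((lam : ℂ) * w⁻¹))).1 - (lam : ℂ) * w⁻¹)) =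
      ((pencilCoord p (u ((lam : ℂ) * w⁻¹))).1)⁻¹
    have hone : (lam : ℂ)⁻¹ * w * ((lam : ℂ) * w⁻¹) = 1 := by rw [← hηinv, mul_inv_cancel₀ hη]
    rw [show (1 : ℂ) + (lam : ℂ)⁻¹ * w *
        ((pencilCoord p (u ((lam : ℂ) * w⁻¹))).1 - (lam : ℂ) * w⁻¹) =
        (lam : ℂ)⁻¹ * w * (pencilCoord p (u ((lam : ℂ) * w⁻¹))).1 by
      rw [mul_sub, hone]; ring, div_mul_cancel_left₀ hη]

/-- **Every member has an admissible scale** (registered helper of `stub_memberSphere`): `u ξ`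
eventually (at infinity) lies in the punctured `ε'`-chart-ball (properness) with
`‖z(u ξ) − ξ‖ ≤ 1` (asymptotics), say for `‖ξ‖ ≥ R`; then `lam = max 4 (2 (|R| + ρ⁻¹ + 3))`
works, as `‖z‖ ≥ ‖ξ‖ − 1`. -/
theorem helper_memberSphere_scale :
    ∀ (S : HomotopySphere 4) (p : S.carrier)
      (J : ∀ x : punctured p, TangentSpace (𝓡 4) x →L[ℝ] TangentSpace (𝓡 4) x) (ε' ρ : ℝ)
      (u : ℂ → punctured p) (b : ℂ), IsPencilMember J u b → 0 < ε' → 0 < ρ →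
      ∃ lam : ℝ, 4 ≤ lam ∧ ∀ ξ : ℂ, lam / 2 ≤ ‖ξ‖ →
        InPuncturedChartBall p ε' (u ξ) ∧ ρ⁻¹ + 1 < ‖(Ycoord p (u ξ)).1‖ ∧
          ‖(Ycoord p (u ξ)).1 - ξ‖ ≤ 1 := by
  intro S p J ε' ρ u b hu hε' hρpos
  have hP : IsPencilPlane J u b := hu
  have h1 : ∀ᶠ ξ in cocompact ℂ, InPuncturedChartBall p ε' (u ξ) :=
    hP.eventually_inPuncturedChartBall hε'
  have h2 : ∀ᶠ ξ in cocompact ℂ, ‖(Ycoord p (u ξ)).1 - ξ‖ ≤ 1 := by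
    filter_upwards [hu.2.2.2.2.1 (Metric.closedBall_mem_nhds (0 : ℂ) one_pos)] with ξ hξ
    simpa using hξ
  have h12 := h1.and h2
  rw [← Metric.cobounded_eq_cocompact, (hasBasis_cobounded_norm (E := ℂ)).eventually_iff] at h12
  obtain ⟨R, -, hR⟩ := h12
  refine ⟨max 4 (2 * (|R| + ρ⁻¹ + 3)), le_max_left _ _, fun ξ hξ => ?_⟩
  have hmax := le_max_right 4 (2 * (|R| + ρ⁻¹ + 3))
  have hρ : 0 < ρ⁻¹ := inv_pos.2 hρpos
  obtain ⟨hbx, hz⟩ := hR (show R ≤ ‖ξ‖ by linarith [le_abs_self R])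
  refine ⟨hbx, ?_, hz⟩
  have htri := norm_sub_norm_le ξ (Ycoord p (u ξ)).1
  rw [norm_sub_rev] at hz
  linarith [abs_nonneg R]

/-- **The flat chart is a submersion** (registered helper of `stub_memberSphere`): the
differential of `Ycoord p` is onto at points of the punctured chart-ball — it is injective
(`realify ∘ D(Ycoord) = Dψ ∘ D(e ∘ val)`, injective by `injective_Dpsi`) between real
`4`-dimensional spaces. -/
theorem helper_memberSphere_YcoordSubmersion :
    ∀ (S : HomotopySphere 4) (p : S.carrier) (ε' : ℝ) (x : punctured p),
      InPuncturedChartBall p ε' x →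
      Function.Surjective (mfderiv (𝓡 4) 𝓘(ℝ, ℂ × ℂ) (Ycoord p) x) := by
  intro S p ε' x hx
  -- the differential as an honest linear map `ℝ⁴ → ℂ × ℂ`
  obtain ⟨L, hL⟩ : ∃ L : EuclideanSpace ℝ (Fin 4) →L[ℝ] ℂ × ℂ,
      ∀ v, L v = mfderiv (𝓡 4) 𝓘(ℝ, ℂ × ℂ) (Ycoord p) x v :=
    ⟨mfderiv (𝓡 4) 𝓘(ℝ, ℂ × ℂ) (Ycoord p) x, fun _ => rfl⟩
  have hinj : Function.Injective L := fun v v' h =>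
    injective_Dpsi hx (by
      have h' := congrArg realify h
      rw [hL v, hL v', realify_mfderiv_Ycoord hx v, realify_mfderiv_Ycoord hx v'] at h'
      exact h')
  have hdim : Module.finrank ℝ (EuclideanSpace ℝ (Fin 4)) = Module.finrank ℝ (ℂ × ℂ) := by
    simp [Module.finrank_prod, Complex.finrank_real_complex]
  have hsurj := (LinearMap.injective_iff_surjective_of_finrank_eq_finrank hdim
    (f := (L : EuclideanSpace ℝ (Fin 4) →ₗ[ℝ] ℂ × ℂ))).1 hinj
  intro w
  obtain ⟨v, hv⟩ := hsurj w
  exact ⟨v, (hL v).symm.trans hv⟩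

/-- **Points with `w`-coordinate `b_f` lie on the far line** (registered helper of
`stub_memberSphere`): on the punctured `ε'`-chart-ball the flat chart `Ycoord p` is injective
(`substub_flatChart`), and `Ycoord ∘ farLine = (·, b_f)`. -/
theorem helper_memberSphere_eq_farLine :
    ∀ (S : HomotopySphere 4) (p : S.carrier) (ε' : ℝ) (hε' : 0 < ε')
      (hball : Metric.closedBall (extChartAt (𝓡 4) p p) ε' ⊆ (extChartAt (𝓡 4) p).target)
      (bf : ℂ) (hbf : ε'⁻¹ < ‖bf‖) (x : punctured p),
      InPuncturedChartBall p ε' x → (Ycoord p x).2 = bf →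
      x = farLine hε' hball hbf (Ycoord p x).1 := by
  intro S p ε' hε' hball bf hbf x hx h2
  obtain ⟨χ, hχ⟩ := exists_flatInv hε' hball
  have e2 := flatInv_Ycoord hε' hχ (farLine_mem_ball hε' hball hbf (Ycoord p x).1)
  rw [Ycoord_farLine] at e2
  calc x = χ (Ycoord p x) := (flatInv_Ycoord hε' hχ hx).symm
    _ = χ ((Ycoord p x).1, bf) := by rw [← h2]
    _ = _ := e2

/-- **The `w`-chart of the compactified member at `w = 0`** (registered helper of
`stub_memberSphere`), for any cap chart: if `capInv : ℂ × ℂ → X` is smooth on `{‖t‖ < ρ}` with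
injective differential intertwining `i` with `JX`, and `capInv (z⁻¹, w) = ι x` for `x` in the
punctured `ε'`-ball with `‖z‖ > ρ⁻¹`, then for a member `u` of intercept `b` at an admissible
scale `lam` any `V` with `V 0 = capInv (0, b)`, `V w = ι (u (lam / w))` (`w ≠ 0`) agrees near `0`
with `capInv ∘ k`, `k` the analytic germ of `helper_memberSphere_capGerm` (`k 0 = (0, b)`,
`k'(0) = (lam⁻¹, c) ≠ 0`); hence `V` is smooth, immersed and `JX`-holomorphic at `0`. -/
theorem helper_memberSphere_Vzero :
    ∀ (S : HomotopySphere 4) (p : S.carrier)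
      (J : ∀ x : punctured p, TangentSpace (𝓡 4) x →L[ℝ] TangentSpace (𝓡 4) x) (ε' : ℝ)
      (u : ℂ → punctured p) (b : ℂ) (lam ρ : ℝ)
      (X : Type) [TopologicalSpace X] [ChartedSpace (EuclideanSpace ℝ (Fin 4)) X]
      [IsManifold (𝓡 4) ∞ X]
      (JX : ∀ y : X, TangentSpace (𝓡 4) y →L[ℝ] TangentSpace (𝓡 4) y)
      (ι : punctured p → X) (capInv : ℂ × ℂ → X) (V : ℂ → X),
      0 < ε' →
      (∀ x : punctured p, InPuncturedChartBall p ε' x →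
        ∀ (v : TangentSpace (𝓡 4) x) (c : EuclideanSpace ℝ (Fin 4)),
          inner ℝ (fderiv ℝ inversion (extChartAt (𝓡 4) p x.1 - extChartAt (𝓡 4) p p)
            (mfderiv (𝓡 4) 𝓘(ℝ, EuclideanSpace ℝ (Fin 4))
              (fun z : punctured p => extChartAt (𝓡 4) p z.1) x (J x v))) c
          = stdSymplecticForm (fderiv ℝ inversion (extChartAt (𝓡 4) p x.1 - extChartAt (𝓡 4) p p)
            (mfderiv (𝓡 4) 𝓘(ℝ, EuclideanSpace ℝ (Fin 4))
              (fun z : punctured p => extChartAt (𝓡 4) p z.1) x v)) c) →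
      IsPencilMember J u b →
      (4 ≤ lam ∧ ∀ ξ : ℂ, lam / 2 ≤ ‖ξ‖ →
        InPuncturedChartBall p ε' (u ξ) ∧ ρ⁻¹ + 1 < ‖(Ycoord p (u ξ)).1‖ ∧
          ‖(Ycoord p (u ξ)).1 - ξ‖ ≤ 1) →
      0 < ρ →
      V 0 = capInv (0, b) →
      (∀ w : ℂ, w ≠ 0 → V w = ι (u ((lam : ℂ) * w⁻¹))) →
      (∀ x : punctured p, InPuncturedChartBall p ε' x → ρ⁻¹ < ‖(Ycoord p x).1‖ →
        capInv (((Ycoord p x).1)⁻¹, (Ycoord p x).2) = ι x) →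
      ContMDiffOn 𝓘(ℝ, ℂ × ℂ) (𝓡 4) ∞ capInv {q : ℂ × ℂ | ‖q.1‖ < ρ} →
      (∀ q : ℂ × ℂ, ‖q.1‖ < ρ → Function.Injective (mfderiv 𝓘(ℝ, ℂ × ℂ) (𝓡 4) capInv q)) →
      (∀ q : ℂ × ℂ, ‖q.1‖ < ρ → ∀ v : ℂ × ℂ,
        JX (capInv q) (mfderiv 𝓘(ℝ, ℂ × ℂ) (𝓡 4) capInv q v) =
          mfderiv 𝓘(ℝ, ℂ × ℂ) (𝓡 4) capInv q (Complex.I • v)) →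
      ContMDiffAt 𝓘(ℝ, ℂ) (𝓡 4) ∞ V 0 ∧ Function.Injective (mfderiv 𝓘(ℝ, ℂ) (𝓡 4) V 0) ∧
      ∀ v : ℂ, mfderiv 𝓘(ℝ, ℂ) (𝓡 4) V 0 (Complex.I * v) =
        JX (V 0) (mfderiv 𝓘(ℝ, ℂ) (𝓡 4) V 0 v) := by
  intro S p J ε' u b lam ρ X _ _ _ JX ι capInv V hε' hstd hu hsc hρ hV0 hVne hcapY hcapsm hcapinj hcapJ
  have hlam4 : 4 ≤ lam := hsc.1
  have hlam0 : lam ≠ 0 := by positivity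
  obtain ⟨k, c, hk, hk', hk0, hkw⟩ :=
    helper_memberSphere_capGerm S p J ε' u b lam hε' hstd hu hlam0
  -- `V = capInv ∘ k` near `0`
  have hVeq : V =ᶠ[𝓝 0] (capInv ∘ k) := by
    filter_upwards [Metric.ball_mem_nhds (0 : ℂ) two_pos] with w hw
    rw [Metric.mem_ball, dist_zero_right] at hw
    by_cases hw0 : w = 0
    · rw [hw0, hV0, Function.comp_apply, hk0]
    · have hξ : lam / 2 ≤ ‖(lam : ℂ) * w⁻¹‖ := by
        rw [norm_mul, norm_inv, Complex.norm_real, Real.norm_of_nonneg (by positivity),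
          ← div_eq_mul_inv]
        exact div_le_div_of_nonneg_left (by positivity) (norm_pos_iff.2 hw0) hw.le
      obtain ⟨hbx, hρx, -⟩ := hsc.2 _ hξ
      rw [Function.comp_apply, hkw w hw0, hVne w hw0]
      exact (hcapY _ hbx (by linarith)).symm
  have hopen : IsOpen {q : ℂ × ℂ | ‖q.1‖ < ρ} :=
    isOpen_lt (continuous_norm.comp continuous_fst) continuous_const
  have hk0mem : ‖(k 0).1‖ < ρ := by rw [hk0, norm_zero]; exact hρ
  have hcap : ContMDiffAt 𝓘(ℝ, ℂ × ℂ) (𝓡 4) ∞ capInv (k 0) :=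
    hcapsm.contMDiffAt (hopen.mem_nhds hk0mem)
  have hksm : ContMDiffAt 𝓘(ℝ, ℂ) 𝓘(ℝ, ℂ × ℂ) ∞ k 0 :=
    ((hk.contDiffAt (n := ∞)).restrict_scalars ℝ).contMDiffAt
  -- the differential at `0`: `dV(0) v = d capInv (k 0) (v • (lam⁻¹, c))`
  have hkL : HasFDerivAt k
      (((1 : ℂ →L[ℂ] ℂ).smulRight ((lam : ℂ)⁻¹, c)).restrictScalars ℝ) 0 :=
    hk'.hasFDerivAt.restrictScalars ℝ
  have h1 : HasMFDerivAt 𝓘(ℝ, ℂ × ℂ) (𝓡 4) capInv (k 0)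
      (mfderiv 𝓘(ℝ, ℂ × ℂ) (𝓡 4) capInv (k 0)) :=
    (hcap.mdifferentiableAt (by simp)).hasMFDerivAt
  have h3 := (h1.comp 0 hkL.hasMFDerivAt).congr_of_eventuallyEq hVeq
  have hmf : ∀ v : ℂ, mfderiv 𝓘(ℝ, ℂ) (𝓡 4) V 0 v =
      mfderiv 𝓘(ℝ, ℂ × ℂ) (𝓡 4) capInv (k 0) (v • ((lam : ℂ)⁻¹, c)) := fun v => by
    rw [h3.mfderiv]
    rfl
  have hJ : ∀ w' : EuclideanSpace ℝ (Fin 4),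
      JX (V 0) w' = JX (capInv (k 0)) w' := fun w' =>
    congrArg (fun y : X =>
      (JX y : EuclideanSpace ℝ (Fin 4) →L[ℝ] EuclideanSpace ℝ (Fin 4)) w') hVeq.eq_of_nhds
  refine ⟨(hcap.comp 0 hksm).congr_of_eventuallyEq hVeq, fun v v' hvv' => ?_, fun v => ?_⟩
  · rw [hmf v, hmf v'] at hvv'
    have h5 := congrArg Prod.fst (hcapinj (k 0) hk0mem hvv')
    simp only [Prod.smul_fst, smul_eq_mul] at h5
    have key : (v : ℂ) = v' :=
      mul_right_cancel₀ (M₀ := ℂ) (inv_ne_zero (Complex.ofReal_ne_zero.2 hlam0)) h5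
    exact key
  · rw [hJ, hmf, hmf, hcapJ (k 0) hk0mem, mul_smul]

end Summit.SmoothPoincare4.SmoothPoincare4.Theorems.WitnessCharge.PencilIncompleteness
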